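import Summits.AtomisticToContinuum.Crystallization.Theorems.ExcessDecayLiouvillePhononStabilityCertTable

/-!
# Near-certificate layer V1: a native positive-semidefiniteness test (lead c2, vertex scheme)

Support file for crux `PhononStability` (stmt-AtomisticToContinuum-9333), line `contragredient-window-collapse`.

`psdCheckZ n a σ` for an INTEGER matrix `a` (entries `a i j`, `i j < n`): it computes an integer Cholesky-type
witness `L` of `a − σ·1` (truncated integer arithmetic, `Nat.sqrt` on the diagonal; no claim is made about `L`)
and then checks EXACTLY that `a` is symmetric and that the residual `E = a − L Lᵀ` is diagonally dominant with
dominating diagonal (all in `ℤ`, explicit loops).  Soundness (`psd_of_psdCheckZ`): `L Lᵀ` is a Gram matrix and a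
symmetric diagonally dominant matrix is positive semidefinite, hence `vᵀ a v ≥ 0` for every real `v`.  This is the
per-vertex test of the vertex scheme (one `54 × 54` matrix per vertex of a cell; rational Gram data are brought to
integers by a common dyadic scale before the call).
-/

noncomputable section

open scoped BigOperators Classical

namespace Summit.AtomisticToContinuum.Crystallization.Theorems.PhononStabilityCWC.Cert

/-! ## Loops as sums -/

/-- `Σ_{k < n} f k` as a left fold over `List.range` (the native loop) -/
def sumRangeZ (n : ℕ) (f : ℕ → ℤ) : ℤ := (List.range n).foldl (fun acc k => acc + f k) 0

/-- the loop is the `Finset.range` sum. [folklore] -/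
theorem sumRangeZ_eq (n : ℕ) (f : ℕ → ℤ) : sumRangeZ n f = ∑ k ∈ Finset.range n, f k := by
  unfold sumRangeZ
  induction n with
  | zero => simp
  | succ m ih =>
      rw [List.range_succ, List.foldl_append, List.foldl_cons, List.foldl_nil, ih, Finset.sum_range_succ]

/-- the `Finset.range` sum over `ℕ` as a sum over `Fin n`. [folklore] -/
theorem sum_range_eq_sum_fin (n : ℕ) (f : ℕ → ℤ) : (∑ k ∈ Finset.range n, f k) = ∑ k : Fin n, f k.val := by
  rw [Finset.sum_range]

/-- `Σ_{k < n} f k` over `ℕ` as a left fold (the native hot loop: small naturals are unboxed) -/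
def sumRangeN (n : ℕ) (f : ℕ → ℕ) : ℕ := (List.range n).foldl (fun acc k => acc + f k) 0

/-- the natural loop is the `Finset.range` sum. [folklore] -/
theorem sumRangeN_eq (n : ℕ) (f : ℕ → ℕ) : sumRangeN n f = ∑ k ∈ Finset.range n, f k := by
  unfold sumRangeN
  induction n with
  | zero => simp
  | succ m ih =>
      rw [List.range_succ, List.foldl_append, List.foldl_cons, List.foldl_nil, ih, Finset.sum_range_succ]

/-! ## The heuristic witness -/

/-- entry accessor of an integer array matrix (`0` outside the stored entries) -/
def aget (L : Array (Array ℤ)) (i k : ℕ) : ℤ := (L.getD i #[]).getD k 0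

/-- heuristic integer Cholesky factor (rows of a lower-triangular `L` with `L Lᵀ ≈ a − σ·1`); no correctness is
claimed or needed. -/
def cholInt (n : ℕ) (a : ℕ → ℕ → ℤ) (σ : ℤ) : Array (Array ℤ) :=
  (List.range n).foldl (fun L i =>
    let rowi := (List.range (i + 1)).foldl (fun (row : Array ℤ) j =>
        if j < i then
          let s := (List.range j).foldl (fun acc k => acc + row.getD k 0 * aget L j k) 0
          let d := aget L j j
          row.push (if d = 0 then 0 else (a i j - s) / d)
        else
          let s := (List.range i).foldl (fun acc k => acc + row.getD k 0 * row.getD k 0) 0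
          let r := a i i - σ - s
          row.push (if r ≤ 0 then 0 else ((Nat.sqrt r.toNat : ℕ) : ℤ))) #[]
    L.push rowi) #[]

/-- natural-number accessor of an array matrix (`0` outside the stored entries) -/
def ngetD (L : Array (Array ℕ)) (i k : ℕ) : ℕ := (L.getD i #[]).getD k 0

/-- positive parts of the witness rows -/
def posPart (L : Array (Array ℤ)) : Array (Array ℕ) := L.map fun row => row.map fun x => x.toNat
/-- negative parts of the witness rows -/
def negPart (L : Array (Array ℤ)) : Array (Array ℕ) := L.map fun row => row.map fun x => (-x).toNat

/-- the two natural Gram sums of the split witness `L = P − N`: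
`(Σ_k Pᵢₖ Pⱼₖ + Nᵢₖ Nⱼₖ, Σ_k Pᵢₖ Nⱼₖ + Nᵢₖ Pⱼₖ)` (native loops over small naturals) -/
def lltPN (P N : Array (Array ℕ)) (n i j : ℕ) : ℕ × ℕ :=
  (sumRangeN n fun k => ngetD P i k * ngetD P j k + ngetD N i k * ngetD N j k,
   sumRangeN n fun k => ngetD P i k * ngetD N j k + ngetD N i k * ngetD P j k)

/-- the exact residual `E = a − L Lᵀ` with `L = P − N` -/
def residZ (a : ℕ → ℕ → ℤ) (P N : Array (Array ℕ)) (n i j : ℕ) : ℤ :=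
  let s := lltPN P N n i j
  a i j - (s.1 : ℤ) + (s.2 : ℤ)

/-- off-diagonal absolute row sum of the residual -/
def offSumZ (a : ℕ → ℕ → ℤ) (P N : Array (Array ℕ)) (n i : ℕ) : ℤ :=
  sumRangeZ n fun j => if j = i then 0 else |residZ a P N n i j|

/-- **the PSD check** on an integer matrix: symmetry and diagonal dominance of the exact residual `a − L Lᵀ`. -/
def psdCheckZ (n : ℕ) (a : ℕ → ℕ → ℤ) (σ : ℤ) : Bool :=
  let L := cholInt n a σ
  let P := posPart L
  let N := negPart L
  ((List.range n).all fun i => (List.range n).all fun j => decide (a i j = a j i)) &&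
    ((List.range n).all fun i => decide (offSumZ a P N n i ≤ residZ a P N n i i))

/-! ## Soundness -/

/-- a real Gram matrix of rows is positive semidefinite. [folklore] -/
theorem gram_rows_nonneg {n : ℕ} (M : Fin n → Fin n → ℝ) (v : Fin n → ℝ) :
    0 ≤ ∑ i, ∑ j, (∑ k, M i k * M j k) * v i * v j := by
  have h : (∑ i, ∑ j, (∑ k, M i k * M j k) * v i * v j) = ∑ k, (∑ i, M i k * v i) ^ 2 := by
    have e1 : (∑ i, ∑ j, (∑ k, M i k * M j k) * v i * v j) = ∑ i, ∑ j, ∑ k, M i k * v i * (M j k * v j) := by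
      refine Finset.sum_congr rfl fun i _ => Finset.sum_congr rfl fun j _ => ?_
      rw [Finset.sum_mul, Finset.sum_mul]
      exact Finset.sum_congr rfl fun k _ => by ring
    rw [e1]
    rw [Finset.sum_comm]
    conv_lhs => arg 2; ext j; rw [Finset.sum_comm]
    rw [Finset.sum_comm]
    refine Finset.sum_congr rfl fun k _ => ?_
    rw [sq, Finset.sum_mul_sum]
    rw [Finset.sum_comm]
  rw [h]
  exact Finset.sum_nonneg fun k _ => sq_nonneg _

/-- a symmetric, diagonally dominant real matrix is positive semidefinite. [folklore] -/
theorem diagDominant_nonneg {n : ℕ} (E : Fin n → Fin n → ℝ) (hsym : ∀ i j, E i j = E j i)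
    (hdd : ∀ i, (∑ j, if j = i then 0 else |E i j|) ≤ E i i) (v : Fin n → ℝ) :
    0 ≤ ∑ i, ∑ j, E i j * v i * v j := by
  have key : ∀ i j, (if j = i then 0 else -|E i j| * ((v i) ^ 2 + (v j) ^ 2) / 2) ≤
      (if j = i then 0 else E i j * v i * v j) := by
    intro i j
    split_ifs with h
    · exact le_rfl
    · have h1 : -(|E i j| * (|v i| * |v j|)) ≤ E i j * v i * v j := by
        have := neg_abs_le (E i j * v i * v j)
        rwa [abs_mul, abs_mul, mul_assoc] at this
      have h2 : |v i| * |v j| ≤ ((v i) ^ 2 + (v j) ^ 2) / 2 := by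
        nlinarith [sq_nonneg (|v i| - |v j|), sq_abs (v i), sq_abs (v j)]
      have h3 : 0 ≤ |E i j| := abs_nonneg _
      nlinarith
  have split : ∀ i, (∑ j, E i j * v i * v j) = E i i * v i * v i + ∑ j, if j = i then 0 else E i j * v i * v j := by
    intro i
    rw [← Finset.sum_erase_add _ _ (Finset.mem_univ i)]
    rw [add_comm]
    congr 1
    rw [← Finset.sum_erase_add _ _ (Finset.mem_univ i)]
    simp only [if_true, add_zero]
    exact Finset.sum_congr rfl fun j hj => by rw [if_neg (Finset.ne_of_mem_erase hj)]
  have lower : ∀ i, E i i * v i * v i + ∑ j, (if j = i then 0 else -|E i j| * ((v i) ^ 2 + (v j) ^ 2) / 2) ≤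
      ∑ j, E i j * v i * v j := by
    intro i
    rw [split i]
    have := Finset.sum_le_sum (s := Finset.univ) fun j (_ : j ∈ Finset.univ) => key i j
    linarith
  have hsum : 0 ≤ ∑ i, (E i i * v i * v i + ∑ j, if j = i then 0 else -|E i j| * ((v i) ^ 2 + (v j) ^ 2) / 2) := by
    have hsplit2 : ∀ i, (∑ j, if j = i then 0 else -|E i j| * ((v i) ^ 2 + (v j) ^ 2) / 2) =
        -(∑ j, if j = i then 0 else |E i j| * (v i) ^ 2 / 2) - ∑ j, if j = i then 0 else |E i j| * (v j) ^ 2 / 2 := by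
      intro i
      rw [← Finset.sum_neg_distrib, ← Finset.sum_sub_distrib]
      refine Finset.sum_congr rfl fun j _ => ?_
      split_ifs <;> ring
    have hswap : (∑ i, ∑ j, if j = i then 0 else |E i j| * (v j) ^ 2 / 2) =
        ∑ i, ∑ j, if j = i then 0 else |E i j| * (v i) ^ 2 / 2 := by
      rw [Finset.sum_comm]
      refine Finset.sum_congr rfl fun i _ => Finset.sum_congr rfl fun j _ => ?_
      by_cases h : i = j
      · subst h; simp
      · rw [if_neg h, if_neg (Ne.symm h), hsym j i]
    have hfac : ∀ i, (∑ j, if j = i then 0 else |E i j| * (v i) ^ 2 / 2) =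
        (∑ j, if j = i then 0 else |E i j|) * (v i) ^ 2 / 2 := by
      intro i
      rw [Finset.sum_mul, Finset.sum_div]
      refine Finset.sum_congr rfl fun j _ => ?_
      split_ifs <;> ring
    calc (0 : ℝ) ≤ ∑ i, (E i i - ∑ j, if j = i then 0 else |E i j|) * (v i) ^ 2 :=
          Finset.sum_nonneg fun i _ => mul_nonneg (sub_nonneg.mpr (hdd i)) (sq_nonneg _)
      _ = ∑ i, (E i i * v i * v i + ∑ j, if j = i then 0 else -|E i j| * ((v i) ^ 2 + (v j) ^ 2) / 2) := by
          simp_rw [hsplit2]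
          rw [show (∑ i, (E i i * v i * v i + (-(∑ j, if j = i then 0 else |E i j| * (v i) ^ 2 / 2) -
              ∑ j, if j = i then 0 else |E i j| * (v j) ^ 2 / 2))) =
              (∑ i, (E i i * v i * v i - ∑ j, if j = i then 0 else |E i j| * (v i) ^ 2 / 2)) -
                ∑ i, ∑ j, if j = i then 0 else |E i j| * (v j) ^ 2 / 2 by
            rw [← Finset.sum_sub_distrib]; exact Finset.sum_congr rfl fun i _ => by ring]
          rw [hswap, ← Finset.sum_sub_distrib]
          refine Finset.sum_congr rfl fun i _ => ?_
          rw [hfac i]; ring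
  exact hsum.trans (Finset.sum_le_sum fun i _ => lower i)

/-- **SOUNDNESS OF THE PSD CHECK:** `psdCheckZ n a σ = true` gives `vᵀ a v ≥ 0` for every real `v`. -/
theorem psd_of_psdCheckZ {n : ℕ} {a : ℕ → ℕ → ℤ} {σ : ℤ} (h : psdCheckZ n a σ = true) (v : Fin n → ℝ) :
    0 ≤ ∑ i : Fin n, ∑ j : Fin n, (a i.val j.val : ℝ) * v i * v j := by
  unfold psdCheckZ at h
  simp only [Bool.and_eq_true, List.all_eq_true, List.mem_range, decide_eq_true_eq] at h
  obtain ⟨hsym, hdd⟩ := h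
  set P := posPart (cholInt n a σ) with hP
  set N := negPart (cholInt n a σ) with hN
  -- the real witness matrix `L = P − N`
  set Lr : Fin n → Fin n → ℝ := fun i k => (ngetD P i.val k.val : ℝ) - (ngetD N i.val k.val : ℝ) with hLr
  have hllt : ∀ i j : Fin n, ((lltPN P N n i.val j.val).1 : ℝ) - ((lltPN P N n i.val j.val).2 : ℝ) =
      ∑ k : Fin n, Lr i k * Lr j k := by
    intro i j
    unfold lltPN
    simp only
    rw [sumRangeN_eq, sumRangeN_eq, Finset.sum_range, Finset.sum_range]
    push_cast
    rw [← Finset.sum_sub_distrib]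
    refine Finset.sum_congr rfl fun k _ => ?_
    rw [hLr]
    ring
  have hres : ∀ i j : Fin n, (residZ a P N n i.val j.val : ℝ) = (a i.val j.val : ℝ) - ∑ k : Fin n, Lr i k * Lr j k := by
    intro i j
    unfold residZ
    simp only
    push_cast
    rw [← hllt]
    ring
  have hsplit : (∑ i : Fin n, ∑ j : Fin n, (a i.val j.val : ℝ) * v i * v j) =
      (∑ i : Fin n, ∑ j : Fin n, (∑ k : Fin n, Lr i k * Lr j k) * v i * v j) +
        ∑ i : Fin n, ∑ j : Fin n, (residZ a P N n i.val j.val : ℝ) * v i * v j := by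
    rw [← Finset.sum_add_distrib]
    refine Finset.sum_congr rfl fun i _ => ?_
    rw [← Finset.sum_add_distrib]
    refine Finset.sum_congr rfl fun j _ => ?_
    rw [hres]
    ring
  have h1 := gram_rows_nonneg Lr v
  have hsymE : ∀ i j : Fin n, (residZ a P N n i.val j.val : ℝ) = residZ a P N n j.val i.val := by
    intro i j
    rw [hres, hres, show (a i.val j.val : ℝ) = a j.val i.val by exact_mod_cast hsym i.val i.isLt j.val j.isLt]
    congr 1
    exact Finset.sum_congr rfl fun k _ => by ring
  have hddE : ∀ i : Fin n, (∑ j : Fin n, if j = i then 0 else |(residZ a P N n i.val j.val : ℝ)|) ≤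
      residZ a P N n i.val i.val := by
    intro i
    have h0 := hdd i.val i.isLt
    unfold offSumZ at h0
    rw [sumRangeZ_eq, sum_range_eq_sum_fin] at h0
    have hc : ((∑ k : Fin n, if k.val = i.val then (0 : ℤ) else |residZ a P N n i.val k.val| : ℤ) : ℝ) =
        ∑ j : Fin n, if j = i then 0 else |(residZ a P N n i.val j.val : ℝ)| := by
      push_cast
      refine Finset.sum_congr rfl fun j _ => ?_
      by_cases hji : j = i
      · subst hji; simp
      · rw [if_neg hji, if_neg (fun h => hji (Fin.ext h))]
    rw [← hc]
    exact_mod_cast h0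
  have h2 := diagDominant_nonneg (fun i j : Fin n => (residZ a P N n i.val j.val : ℝ)) hsymE hddE v
  rw [hsplit]
  exact add_nonneg h1 h2

/-- Anchor of this support file (registered stub of the line skeleton, lead c2): the check accepts `4·1` on `ℤ²`. -/
theorem stub_certPSD : psdCheckZ 2 (fun i j => if i = j then 4 else 0) 1 = true := by
  decide +kernel

end Summit.AtomisticToContinuum.Crystallization.Theorems.PhononStabilityCWC.Cert

end
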